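import Summits.NavierStokesRegularity.NavierStokesRegularity.Theorems.ExtremiserTransienceNearExtremalTransienceExtremiserLiouvilleConstantSpeedDecayLiouville
import Summits.NavierStokesRegularity.NavierStokesRegularity.Theorems.ExtremiserTransienceNearExtremalTransienceExtremiserLiouvilleConstantSpeedL2LiouvilleGeneral
import Summits.NavierStokesRegularity.NavierStokesRegularity.Theorems.ExtremiserTransienceNearExtremalTransienceExtremiserLiouvilleConstantSpeedResidue
import HarnessLib

/-!
# Crux `ExtremiserTransience.NearExtremalTransience` (stmt-NavierStokesRegularity-21883), line `extremiser_liouville`,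
# stub K1b — decay-gap Liouville, GENERAL far-field direction; the K1b residue has an exact `|x|⁻¹` tail

`--supports stmt-NavierStokesRegularity-21883` (helper).  Author: prover seat `ns-el-k1b` (g4).

`eq_farField_of_constSpeed_of_decay`: **a `C¹` divergence-free field on `ℝ³` with constant speed `‖w‖ ≡ M = ‖c‖`, `c ≠ 0`,
and `‖w(x) − c‖ ≤ C(1 + ‖x‖)^{-a}` for some `a > 1` is the constant `c`** — the axial case `…ConstantSpeedDecayLiouville`
conjugated by the reflection `R` with `R c = ‖c‖ e₃` (as in g3's `…L2LiouvilleGeneral`; the decay hypothesis is invariant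
because `R` is an isometry).

CONSEQUENCE FOR K1b (`residue_not_littleO`-type reading, stated in the docstring only): the residue object (a constant-speed
analytic extended extremiser with far field `c`, `M > 0`, not constant) is NOT `O(|x|^{-a})` for any `a > 1`, while the
explicit non-extremal example `…ConstantSpeedExample` has an exact `|x|⁻¹` tail.  So the «decay window» of the line is closed
from both sides: the open part of K1b is precisely the exact-`|x|⁻¹` regime, which only the extremality (the multiplier
`q ∈ L¹`, record item 7 (C)) can exclude.

WHAT THIS IS NOT: K1b is NOT proved; nothing here proves NS regularity. [folklore]
-/

noncomputable section

open Set Filter Topology MeasureTheory Metric Function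
open scoped ENNReal NNReal Topology InnerProductSpace RealInnerProductSpace ContDiff
open Literature.Analysis.FluidPDE Literature.Analysis

namespace Summit.NavierStokesRegularity.NavierStokesRegularity.Theorems

-- the problem directory repeats the summit name (`NavierStokesRegularity/NavierStokesRegularity`)
set_option linter.dupNamespace false

namespace ExtremiserLiouville

/-- **Decay-gap Liouville, general direction.**  If `w ∈ C¹(ℝ³;ℝ³)` is divergence free with `‖w‖ ≡ M = ‖c‖`, `c ≠ 0`,
and `‖w(x) − c‖ ≤ C₀ (1 + ‖x‖)^{-a}` for some `a > 1`, then `w ≡ c`.  Sharp: `a = 1` does not suffice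
(`ConstantSpeedExample.exists_admissible_constantSpeed_nonconstant`). [folklore] -/
theorem eq_farField_of_constSpeed_of_decay {w : EuclideanSpace ℝ (Fin 3) → EuclideanSpace ℝ (Fin 3)}
    (hw : ContDiff ℝ 1 w) (hdiv : VectorCalculus.IsDivFree w) {M : ℝ} {c : EuclideanSpace ℝ (Fin 3)}
    (hM : ∀ x, ‖w x‖ = M) (hcM : ‖c‖ = M) (hc : c ≠ 0) {a C₀ : ℝ} (ha : 1 < a) (hC₀ : 0 ≤ C₀)
    (hdec : ∀ x, ‖w x - c‖ ≤ C₀ * (1 + ‖x‖) ^ (-a)) : ∀ x, w x = c := by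
  -- the reflection taking `c` to `‖c‖ e₃` (as in `eq_farField_of_constSpeed_of_sq_integrable`)
  set e : EuclideanSpace ℝ (Fin 3) := ‖c‖ • EuclideanSpace.single (2 : Fin 3) (1 : ℝ) with he
  have hce : ‖c‖ = ‖e‖ := by
    rw [he, norm_smul, Real.norm_eq_abs, abs_of_nonneg (norm_nonneg _), PiLp.norm_single, norm_one, mul_one]
  set R : EuclideanSpace ℝ (Fin 3) ≃ₗᵢ[ℝ] EuclideanSpace ℝ (Fin 3) := Submodule.reflection (ℝ ∙ (c - e))ᗮ with hR
  have hRc : R c = e := Submodule.reflection_sub hce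
  set w' : EuclideanSpace ℝ (Fin 3) → EuclideanSpace ℝ (Fin 3) := fun y => R (w (R.symm y)) with hw'
  have hw'1 : ContDiff ℝ 1 w' :=
    R.toContinuousLinearEquiv.contDiff.comp (hw.comp R.symm.toContinuousLinearEquiv.contDiff)
  have hdiv' : VectorCalculus.IsDivFree w' := hdiv.conj_linearIsometryEquiv R
  have hM' : ∀ x, ‖w' x‖ = M := fun x => by rw [hw', R.norm_map, hM]
  have heM : ‖e‖ = M := by rw [← hce, hcM]
  have he0 : e 0 = 0 := by simp [he]
  have he1 : e 1 = 0 := by simp [he]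
  have he2 : e 2 ≠ 0 := by
    have : e 2 = ‖c‖ := by simp [he]
    rw [this]; exact norm_ne_zero_iff.2 hc
  -- the decay hypothesis is invariant under the isometry
  have hdec' : ∀ y, ‖w' y - e‖ ≤ C₀ * (1 + ‖y‖) ^ (-a) := fun y => by
    have h1 : ‖w' y - e‖ = ‖w (R.symm y) - c‖ := by
      simp only [hw']
      rw [← hRc, ← map_sub, R.norm_map]
    rw [h1, ← R.symm.norm_map y]
    exact hdec (R.symm y)
  have h := eq_farField_of_constSpeed_of_decay_axial hw'1 hdiv' hM' heM he0 he1 he2 ha hC₀ hdec'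
  intro x
  have hx := h (R x)
  simp only [hw', LinearIsometryEquiv.symm_apply_apply] at hx
  rw [← hRc] at hx
  exact R.injective hx


/-- **K1b ⟸ DECAY RATE OF THE RESIDUE (the line's new Lean-sized target (N0'')).**  If every constant-speed analytic
extended extremiser `w` (all structural hypotheses of the stub, `‖w‖ ≡ M`, `|S| = κ⋆ M √Z √W > 0`) with far field `c`
(`‖c‖ = M`, `w → c` at infinity) satisfies `‖w(x) − c‖ ≤ C(1 + ‖x‖)^{-a}` for SOME `a > 1`, then K1b
(`stub_noAnalyticExtremal`, verbatim) holds: by the plateau theorem an analytic extended extremiser has constant speed, it has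
a far field (`exists_inner_farField_nonpos_of_constSpeed_extremal`), the hypothesis gives the decay, the decay-gap Liouville
makes it constant, and a constant field has `Z = 0`.  The exponent `a = 1` is exactly what the explicit example realises, so
(N0'') asks for the first digit beyond the function-space information. [folklore] -/
theorem stub_noAnalyticExtremal_of_residueDecay
    (hres : ∀ (w : EuclideanSpace ℝ (Fin 3) → EuclideanSpace ℝ (Fin 3)) (c : EuclideanSpace ℝ (Fin 3)) (M : ℝ),
      AnalyticOnNhd ℝ w Set.univ → ContDiff ℝ (⊤ : ℕ∞) w → Literature.Analysis.FluidPDE.VectorCalculus.IsDivFree w →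
      (∃ B : ℝ, ∀ x, ‖fderiv ℝ w x‖ ≤ B) → (∫⁻ x, ‖iteratedFDeriv ℝ 1 w x‖ₑ ^ 2 < ⊤) → (∫⁻ x, ‖iteratedFDeriv ℝ 2 w x‖ₑ ^ 2 < ⊤) →
      (∀ x, ‖w x‖ = M) → ‖c‖ = M → Filter.Tendsto (fun x => w x - c) (Filter.cocompact (EuclideanSpace ℝ (Fin 3))) (nhds 0) →
      0 < M * Real.sqrt (∫ x, ‖Literature.Analysis.FluidPDE.curl w x‖ ^ 2) * Real.sqrt (∫ x, Literature.Analysis.FluidPDE.frobeniusNormSq (fderiv ℝ (Literature.Analysis.FluidPDE.curl w) x)) →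
      (sInf {κ : ℝ | (∀ (v : EuclideanSpace ℝ (Fin 3) → EuclideanSpace ℝ (Fin 3)) (M B : ℝ), ContDiff ℝ (⊤ : ℕ∞) v → Literature.Analysis.FluidPDE.VectorCalculus.IsDivFree v → (∀ x, ‖v x‖ ≤ M) → (∀ x, ‖fderiv ℝ v x‖ ≤ B) → (∫⁻ x, ‖iteratedFDeriv ℝ 0 v x‖ₑ ^ 2 < ⊤) → (∫⁻ x, ‖iteratedFDeriv ℝ 1 v x‖ₑ ^ 2 < ⊤) → (∫⁻ x, ‖iteratedFDeriv ℝ 2 v x‖ₑ ^ 2 < ⊤) → |∫ x, ⟪Literature.Analysis.FluidPDE.curl v x, fderiv ℝ v x (Literature.Analysis.FluidPDE.curl v x)⟫_ℝ| ≤ κ * M * Real.sqrt (∫ x, ‖Literature.Analysis.FluidPDE.curl v x‖ ^ 2) * Real.sqrt (∫ x, Literature.Analysis.FluidPDE.frobeniusNormSq (fderiv ℝ (Literature.Analysis.FluidPDE.curl v) x)))}) * M * Real.sqrt (∫ x, ‖Literature.Analysis.FluidPDE.curl w x‖ ^ 2) * Real.sqrt (∫ x, Literature.Analysis.FluidPDE.frobeniusNormSq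 (fderiv ℝ (Literature.Analysis.FluidPDE.curl w) x)) = |∫ x, ⟪Literature.Analysis.FluidPDE.curl w x, fderiv ℝ w x (Literature.Analysis.FluidPDE.curl w x)⟫_ℝ| →
      ∃ a C₀ : ℝ, 1 < a ∧ 0 ≤ C₀ ∧ ∀ x, ‖w x - c‖ ≤ C₀ * (1 + ‖x‖) ^ (-a)) :
    ¬ ∃ (w : EuclideanSpace ℝ (Fin 3) → EuclideanSpace ℝ (Fin 3)), AnalyticOnNhd ℝ w Set.univ ∧ (ContDiff ℝ (⊤ : ℕ∞) w ∧ Literature.Analysis.FluidPDE.VectorCalculus.IsDivFree w ∧ (∃ B : ℝ, ∀ x, ‖fderiv ℝ w x‖ ≤ B) ∧ (∫⁻ x, ‖iteratedFDeriv ℝ 1 w x‖ₑ ^ 2 < ⊤) ∧ (∫⁻ x, ‖iteratedFDeriv ℝ 2 w x‖ₑ ^ 2 < ⊤) ∧ ∃ M : ℝ, (∀ x, ‖w x‖ ≤ M) ∧ 0 < M * Real.sqrt (∫ x, ‖Literature.Analysis.FluidPDE.curl w x‖ ^ 2) * Real.sqrt (∫ x, Literature.Analysis.FluidPDE.frobeniusNormSq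 (fderiv ℝ (Literature.Analysis.FluidPDE.curl w) x)) ∧ (sInf {κ : ℝ | (∀ (v : EuclideanSpace ℝ (Fin 3) → EuclideanSpace ℝ (Fin 3)) (M B : ℝ), ContDiff ℝ (⊤ : ℕ∞) v → Literature.Analysis.FluidPDE.VectorCalculus.IsDivFree v → (∀ x, ‖v x‖ ≤ M) → (∀ x, ‖fderiv ℝ v x‖ ≤ B) → (∫⁻ x, ‖iteratedFDeriv ℝ 0 v x‖ₑ ^ 2 < ⊤) → (∫⁻ x, ‖iteratedFDeriv ℝ 1 v x‖ₑ ^ 2 < ⊤) → (∫⁻ x, ‖iteratedFDeriv ℝ 2 v x‖ₑ ^ 2 < ⊤) → |∫ x, ⟪Literature.Analysis.FluidPDE.curl v x, fderiv ℝ v x (Literature.Analysis.FluidPDE.curl v x)⟫_ℝ| ≤ κ * M * Real.sqrt (∫ x, ‖Literature.Analysis.FluidPDE.curl v x‖ ^ 2) * Real.sqrt (∫ x, Literature.Analysis.FluidPDE.frobeniusNormSq (fderiv ℝ (Literature.Analysis.FluidPDE.curl v) x)))}) * M * Real.sqrt (∫ x, ‖Literature.Analysis.FluidPDE.curl w x‖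 ^ 2) * Real.sqrt (∫ x, Literature.Analysis.FluidPDE.frobeniusNormSq (fderiv ℝ (Literature.Analysis.FluidPDE.curl w) x)) ≤ |∫ x, ⟪Literature.Analysis.FluidPDE.curl w x, fderiv ℝ w x (Literature.Analysis.FluidPDE.curl w x)⟫_ℝ|) := by
  refine stub_noAnalyticExtremal_iff_noConstantSpeedExtremiser.2 ?_
  rintro ⟨w, han, hcd, hdiv, ⟨B, hB⟩, h1, h2, M, hM, hpos, hge⟩
  have hle := extendedSharp w M B hcd hdiv (fun x => (hM x).le) hB h1 h2
  have heq := le_antisymm hge hle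
  obtain ⟨c, hcM, hfar, -⟩ :=
    exists_inner_farField_nonpos_of_constSpeed_extremal hcd hdiv hM hB h1 h2 hpos heq.symm
  obtain ⟨a, C₀, ha, hC₀, hdecay⟩ := hres w c M han hcd hdiv ⟨B, hB⟩ h1 h2 hM hcM hfar hpos heq
  -- `c ≠ 0` (else `M = 0` and `hpos` fails)
  have hMpos : 0 < M := by
    have hZ0 : 0 ≤ Real.sqrt (∫ x, ‖curl w x‖ ^ 2) := Real.sqrt_nonneg _
    have hW0 : 0 ≤ Real.sqrt (∫ x, frobeniusNormSq (fderiv ℝ (curl w) x)) := Real.sqrt_nonneg _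
    have hM0 : 0 ≤ M := (norm_nonneg _).trans (hM 0).le
    rcases hM0.lt_or_eq with h | h
    · exact h
    · rw [← h, zero_mul, zero_mul] at hpos; exact absurd hpos (lt_irrefl 0)
  have hc : c ≠ 0 := by
    intro h0; rw [h0, norm_zero] at hcM; linarith
  have hw1 : ContDiff ℝ 1 w := contDiff_infty.1 hcd 1
  have hconst := eq_farField_of_constSpeed_of_decay hw1 hdiv hM hcM hc ha hC₀ hdecay
  have hw : w = fun _ => c := funext hconst
  have hcurl : ∀ x, curl w x = 0 := fun x => by
    rw [hw, curl_eq_curlCLM, fderiv_const_apply, map_zero]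
  have hZ : (∫ x, ‖curl w x‖ ^ 2) = 0 := by simp [hcurl]
  rw [hZ, Real.sqrt_zero, mul_zero, zero_mul] at hpos
  exact lt_irrefl _ hpos

end ExtremiserLiouville

end Summit.NavierStokesRegularity.NavierStokesRegularity.Theorems

end
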